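import Summits.BirchSwinnertonDyer.BirchSwinnertonDyer.Theorems.ThetaPartnerAtTwoSignedKatoUpToAtTwoFrameRigidity
import Literature.NumberTheory.EllipticCurves.Kato2004.EulerSystemValues
import Literature.NumberTheory.GaloisRepresentations.CyclotomicCharacterSurjectiveProofs
import Literature.AnabelianGeometry.EtaleTheta.RootsOfUnityGaloisPrimePower
import HarnessLib

/-!
# K3 `SignedKatoDivisibilityUpToAtTwo`, line `colemanrat` — FRAME-B brick: any two COHERENT towers of `2`-power embeddings
# `ℚ(ζ_{2^k}) → ℚ̄₂` differ by ONE element of `G_{ℚ₂}` (in the kernel)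

Cell `pub/bsd-wall`, width seat `bsd-wall-tp2-p2x-w3` g11, `--supports stmt-BirchSwinnertonDyer-20308` (helper; closes nothing).
Brick for the print-shaped form of `F := Kato2004.exists_eulerSystem_expStar_tatePairing_values_two` (p640688; sequel
`…FramePrint.lean`): the lead's audit `Cruxes/SignedKatoDivisibilityUpToAtTwo/G9-LEAD-AUDIT.md` §4 lists «ONE ψ_u for the whole tower
(cyclotomic character of G_{ℚ₂} onto ℤ₂ˣ acting simultaneously on a coherent tower)» as MISSING. Here:

* `irreducible_cyclotomic_two_pow_mul_one` — `Φ_{2^k}` is irreducible over `ℚ₂` (the tree's `irreducible_cyclotomic_prime_pow_padic`);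
* `exists_gal_of_coherent_towers` — for coherent `e, e'` there is `ψ ∈ G_{ℚ₂}` with `ψ • e_k(ζ) = e'_k(ζ)` for ALL `k`: the closed sets
  `{σ | σ • e_k ζ = e'_k ζ}` DECREASE BY COHERENCE and are non-empty level-wise (`RootOfUnityAction.exists_smul_eq_pow_and_smul_eq_self`),
  so they meet by compactness of `G_{ℚ₂}` — no `ℤ₂ˣ` bookkeeping needed;
* `gal_comp_eq_of_smul_zeta_eq` — then `ψ ∘ e_k = e'_k` (power basis).

Theorems only (no `def`, no fact, no instance); standard axioms. Nothing here settles K3/K3P′; BSD is not proved by any of this.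
-/

noncomputable section

open scoped Classical
open Field Polynomial
open Literature.NumberTheory.GaloisRepresentations
open Literature.NumberTheory.EllipticCurves.Kato2004.EulerSystemValues

set_option linter.dupNamespace false

namespace Summit.BirchSwinnertonDyer.BirchSwinnertonDyer.Theorems.SignedKatoOffTwo.FrameChange

/-! ## §1 Any two coherent towers differ by one element of `G_{ℚ₂}` -/

/-- `Φ_{2^k}` is irreducible over `ℚ₂` for every `k` (`k = 0`: `X − 1`). [cite: SerreLocalFields1979, IV §4 Prop. 17] -/
theorem irreducible_cyclotomic_two_pow_mul_one (k : ℕ) : Irreducible (cyclotomic (2 ^ k * 1) ℚ_[2]) := by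
  rw [mul_one]
  rcases Nat.eq_zero_or_pos k with rfl | hk
  · rw [pow_zero, cyclotomic_one]
    exact irreducible_X_sub_C 1
  · exact Literature.AnabelianGeometry.EtaleTheta.irreducible_cyclotomic_prime_pow_padic 2 hk

set_option backward.isDefEq.respectTransparency false in
/-- **Any two COHERENT towers of `2`-power embeddings differ by ONE `ψ ∈ G_{ℚ₂}`.** For coherent `e, e'`
(`e_{k+1}(ζ_{2^{k+1}})² = e_k(ζ_{2^k})`) there is `ψ ∈ G_{ℚ₂}` with `ψ • e_k(ζ) = e'_k(ζ)` for every `k`: the closed sets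
`Z_k = {σ | σ • e_k ζ = e'_k ζ}` decrease (square the level-`k+1` identity) and are non-empty (`e'_k ζ = (e_k ζ)^i`, `i` odd, and some `σ`
raises all `2^k`-th roots of unity to the `i`-th power since `Φ_{2^k}` is irreducible over `ℚ₂`), so `⋂ Z_k ≠ ∅` by compactness.
[cite: Washington1997, Ch. 14 p. 321] -/
theorem exists_gal_of_coherent_towers (e e' : ∀ k : ℕ, CyclotomicField (cycLevel 2 k ∅) ℚ →ₐ[ℚ] PadicAlgCl 2)
    (hcoh : ∀ k : ℕ, e (k + 1) (IsCyclotomicExtension.zeta (cycLevel 2 (k + 1) ∅) ℚ (CyclotomicField (cycLevel 2 (k + 1) ∅) ℚ)) ^ 2 =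
      e k (IsCyclotomicExtension.zeta (cycLevel 2 k ∅) ℚ (CyclotomicField (cycLevel 2 k ∅) ℚ)))
    (hcoh' : ∀ k : ℕ, e' (k + 1) (IsCyclotomicExtension.zeta (cycLevel 2 (k + 1) ∅) ℚ (CyclotomicField (cycLevel 2 (k + 1) ∅) ℚ)) ^ 2 =
      e' k (IsCyclotomicExtension.zeta (cycLevel 2 k ∅) ℚ (CyclotomicField (cycLevel 2 k ∅) ℚ))) :
    ∃ ψ : Field.absoluteGaloisGroup ℚ_[2], ∀ k : ℕ,
      ψ • e k (IsCyclotomicExtension.zeta (cycLevel 2 k ∅) ℚ (CyclotomicField (cycLevel 2 k ∅) ℚ)) =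
        e' k (IsCyclotomicExtension.zeta (cycLevel 2 k ∅) ℚ (CyclotomicField (cycLevel 2 k ∅) ℚ)) := by
  let Z : ℕ → Set (absoluteGaloisGroup ℚ_[2]) := fun k =>
    {σ | σ • e k (IsCyclotomicExtension.zeta (cycLevel 2 k ∅) ℚ (CyclotomicField (cycLevel 2 k ∅) ℚ)) =
      e' k (IsCyclotomicExtension.zeta (cycLevel 2 k ∅) ℚ (CyclotomicField (cycLevel 2 k ∅) ℚ))}
  have hZclosed : ∀ k, IsClosed (Z k) := fun k => RootOfUnityAction.isClosed_setOf_smul_eq _ _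
  have hZanti : ∀ k, Z (k + 1) ⊆ Z k := by
    intro k σ hσ
    change σ • _ = _
    rw [← hcoh k, ← hcoh' k, smul_pow']
    exact congrArg (· ^ 2) hσ
  have hZne : ∀ k, (Z k).Nonempty := by
    intro k
    haveI : NeZero (2 ^ k) := ⟨pow_ne_zero k two_ne_zero⟩
    have h2k : cycLevel 2 k ∅ = 2 ^ k := by simp [cycLevel]
    have hprim : IsPrimitiveRoot (e k (IsCyclotomicExtension.zeta (cycLevel 2 k ∅) ℚ (CyclotomicField (cycLevel 2 k ∅) ℚ))) (2 ^ k) := by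
      rw [← h2k]
      exact (IsCyclotomicExtension.zeta_spec (cycLevel 2 k ∅) ℚ (CyclotomicField (cycLevel 2 k ∅) ℚ)).map_of_injective
        (e k).toRingHom.injective
    have hprim' : IsPrimitiveRoot (e' k (IsCyclotomicExtension.zeta (cycLevel 2 k ∅) ℚ (CyclotomicField (cycLevel 2 k ∅) ℚ))) (2 ^ k) := by
      rw [← h2k]
      exact (IsCyclotomicExtension.zeta_spec (cycLevel 2 k ∅) ℚ (CyclotomicField (cycLevel 2 k ∅) ℚ)).map_of_injective
        (e' k).toRingHom.injective
    obtain ⟨i, hi, heq⟩ := hprim.eq_pow_of_pow_eq_one hprim'.pow_eq_one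
    have hcop : i.Coprime (2 ^ k) := (hprim.pow_iff_coprime (pow_pos two_pos k) i).mp (heq ▸ hprim')
    obtain ⟨σ, hσA, -⟩ := RootOfUnityAction.exists_smul_eq_pow_and_smul_eq_self (K := ℚ_[2]) (A := 2 ^ k) (B := 1)
      (Nat.coprime_one_right _) (irreducible_cyclotomic_two_pow_mul_one k) (ZMod.unitOfCoprime i hcop)
    refine ⟨σ, ?_⟩
    change σ • _ = _
    rw [hσA _ hprim.pow_eq_one, ZMod.coe_unitOfCoprime, ZMod.val_natCast, Nat.mod_eq_of_lt hi, heq]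
  obtain ⟨ψ, hψ⟩ := IsCompact.nonempty_iInter_of_sequence_nonempty_isCompact_isClosed Z hZanti hZne
    (hZclosed 0).isCompact hZclosed
  exact ⟨ψ, fun k => Set.mem_iInter.mp hψ k⟩

set_option backward.isDefEq.respectTransparency false in
/-- If `ψ • e_k(ζ) = e'_k(ζ)` then `ψ ∘ e_k = e'_k` (power basis of `ℚ(ζ_{2^k})`). [folklore] -/
theorem gal_comp_eq_of_smul_zeta_eq (e e' : ∀ k : ℕ, CyclotomicField (cycLevel 2 k ∅) ℚ →ₐ[ℚ] PadicAlgCl 2)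
    (ψ : Field.absoluteGaloisGroup ℚ_[2]) (g : AlgebraicClosure ℚ_[2] →ₐ[ℚ] AlgebraicClosure ℚ_[2]) (hg : ∀ x, g x = ψ • x)
    (hψ : ∀ k : ℕ, ψ • e k (IsCyclotomicExtension.zeta (cycLevel 2 k ∅) ℚ (CyclotomicField (cycLevel 2 k ∅) ℚ)) =
      e' k (IsCyclotomicExtension.zeta (cycLevel 2 k ∅) ℚ (CyclotomicField (cycLevel 2 k ∅) ℚ)))
    (k : ℕ) (y : CyclotomicField (cycLevel 2 k ∅) ℚ) : (g.comp (e k)) y = e' k y := by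
  have hA : g.comp (e k) = e' k := by
    refine ((IsCyclotomicExtension.zeta_spec (cycLevel 2 k ∅) ℚ (CyclotomicField (cycLevel 2 k ∅) ℚ)).powerBasis ℚ).algHom_ext ?_
    rw [IsPrimitiveRoot.powerBasis_gen, AlgHom.comp_apply, hg]
    exact hψ k
  rw [hA]

end Summit.BirchSwinnertonDyer.BirchSwinnertonDyer.Theorems.SignedKatoOffTwo.FrameChange

end
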